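import Summits.CriticalPhenomena.Ising3DConformalLimit.Theorems.AnomalousForcesInteractionGaussianLimitIsFreeReductions
import Summits.CriticalPhenomena.Ising3DConformalLimit.Theorems.AnomalousForcesInteractionGaussianLimitIsFreeGibbsDecoupling
import HarnessLib

/-!
# Crux `GaussianLimitIsFree` (item stmt-CriticalPhenomena-2601), line `registered` (skeleton v11, lead c4):
# the crux as a pure INHERITANCE statement along the realising lattice sequence

THEOREM-ONLY file (`--supports stmt-CriticalPhenomena-2601`, registered sub-goal `stub_crux_of_inheritance`).
`fieldRealisation_proof` (item 11245) realises the normalised `U₄`-free limit `S = (√A)ⁿ·W_Δ` as the limit IN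
LAW `μ` of the smeared critical plus state, `μ_δ = spinFieldLaw ν (box 3 ⌊δ⁻²⌋) δ (ρ δ) ⇀ μ` (`ν` the plus DLR
state at `β_c`, `exists_limitLaw`, Minlos).  Opening that construction inside the composition of the line
gives the crux from a statement whose hypotheses contain the whole approximating sequence:

* `GaussianLimitIsFree_of_inheritance` (= `stub_crux_of_inheritance`) — **the crux follows from**
  `stub_sphereDecoupling_inheritance`: for `ρ, Δ, A, S, μ` as in the v10 stub (normalised non-degenerate
  translation-invariant scale-covariant pointwise limit `S = (√A)ⁿ·W_Δ` of `criticalCorr 3`, `μ` a centred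
  GAUSSIAN probability law with all moments, exponential moments and moment densities `S`) which is MOREOVER
  the limit in law of `spinFieldLaw ν (box 3 ⌊δ⁻²⌋) δ (ρ δ)` as `δ → 0⁺` for a critical plus DLR state `ν`
  (`ν ∈ isingGibbsMeasures 3 β_c 0`, `spinCorr ν = plusCorr 3 β_c 0`), the decoupling inequality (D_ε) holds
  for `μ` at every width `ε > 0`;
* `sphereDecoupling_approximants` — **and (D_ε) HOLDS for every term of that sequence** with
  `0 < δ ≤ 1/2`, `δ < ε` (`stub_sphereDecoupling_gibbs`; the box `⌊δ⁻²⌋` contains every site within `1 + δ`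
  of the origin at mesh `δ`, `mem_box_of_norm_smul_le`);
* `inheritance_of_sphereDecoupling` — the v10 stub implies the v11 stub (drop the lattice hypotheses), so
  crux 11236, its ball stub and the thick-shell inheritance still discharge it (…Reductions.lean).

So the single open statement of the line now reads, with nothing hidden in an existential: "(D) — proved
for every `μ_δ`, `δ < ε` — survives `μ_δ ⇀ μ` when the limit is Gaussian".  Note the direction of the only
possible failure: explained variance `‖E[X | Y]‖₂²` is weakly LOWER semicontinuous under joint convergence in
law of `(X, Y)` with `Y` finite-dimensional, so `‖E_{μ_δ}[ω(w) | collar]‖₂` can only be asymptotically LARGER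
than its continuum counterpart; (D) for `μ` therefore needs an UPPER bound on the lattice side — the microscopic
collar spins must not predict the interior observable `ω(w)` better, in the limit, than the smeared collar
field does — and for the radial `w = u₁ − λu₂` of the rigidity this is the vanishing of
`lim_ε limsup_δ ‖E_ν[Φ_δ(w) | σ(collar spins)]‖_{L²(ν)}`, a boundary-condition-insensitivity statement for the
critical magnetisation profile in a ball for which no tool is in print.

References: J. Glimm, A. Jaffe, *Quantum Physics* (1987) §6.1; S. Friedli, Y. Velenik (2017) §3.6.3, §6.3;
Yu. A. Rozanov, *Markov Random Fields* (1982), Ch. 2 §1.1, Ch. 3 §2.3; C. M. Newman, CMP 41 (1975).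
-/

noncomputable section

namespace Summit.CriticalPhenomena.Ising3DConformalLimit.Cruxes.GaussianLimitIsFree.Birth

open MeasureTheory Filter Set
open scoped BigOperators Topology SchwartzMap
open Literature.MathematicalPhysics.QuantumLattice
open Literature.Probability.LatticeModels
open Summit.CriticalPhenomena.Ising3DConformalLimit.Theses.AnomalousForcesInteraction (GaussianLimitIsFree)
open Summit.CriticalPhenomena.Ising3DConformalLimit.MoebiusLimitExistsOnlyInteraction (wickPower)
open Literature.Barriers.CriticalPhenomena.ScaleNotMoebius (axisUnit)

/-! ### (D) along the realising sequence -/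

/-- For `0 < δ ≤ 1/2` the box `box 3 ⌊δ⁻²⌋` contains every site `x` with `‖δx‖ ≤ 1 + δ`
(`|xᵢ| ≤ ‖x‖ ≤ δ⁻¹ + 1 ≤ δ⁻² − 1 < ⌊δ⁻²⌋`). [folklore] -/
theorem mem_box_of_norm_smul_le {δ : ℝ} (hδ : 0 < δ) (hδ2 : δ ≤ 1 / 2) {x : Site 3}
    (hx : ‖δ • siteToE x‖ ≤ 1 + δ) : x ∈ box 3 ⌊δ⁻¹ ^ 2⌋₊ := by
  rw [mem_box]
  intro i
  have hnorm : ‖siteToE x‖ ≤ δ⁻¹ + 1 := by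
    rw [norm_smul, Real.norm_eq_abs, abs_of_pos hδ] at hx
    have : ‖siteToE x‖ ≤ (1 + δ) / δ := by
      rw [le_div_iff₀ hδ]; linarith
    have e : (1 + δ) / δ = δ⁻¹ + 1 := by field_simp
    linarith [e ▸ this]
  have hcoord : |(x i : ℝ)| ≤ δ⁻¹ + 1 := by
    have h := PiLp.norm_apply_le (p := 2) (siteToE x) i
    rw [siteToE_apply, Real.norm_eq_abs] at h
    exact h.trans hnorm
  -- `δ⁻¹ + 1 ≤ δ⁻² - 1 < ⌊δ⁻²⌋`
  have ht : 2 ≤ δ⁻¹ := by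
    rw [le_inv_comm₀ two_pos hδ]; linarith
  have hsq : δ⁻¹ + 1 ≤ δ⁻¹ ^ 2 - 1 := by nlinarith
  have hfl : δ⁻¹ ^ 2 - 1 < (⌊δ⁻¹ ^ 2⌋₊ : ℕ) := Nat.sub_one_lt_floor _
  have hlt : |(x i : ℝ)| < (⌊δ⁻¹ ^ 2⌋₊ : ℕ) := lt_of_le_of_lt (hcoord.trans hsq) hfl
  obtain ⟨hlo, hhi⟩ := abs_lt.1 hlt
  have hlo' : ((-((⌊δ⁻¹ ^ 2⌋₊ : ℕ) : ℤ) : ℤ) : ℝ) < ((x i : ℤ) : ℝ) := by push_cast; linarith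
  have hhi' : ((x i : ℤ) : ℝ) < (((⌊δ⁻¹ ^ 2⌋₊ : ℕ) : ℤ) : ℝ) := by push_cast; linarith
  have hlo'' : (-((⌊δ⁻¹ ^ 2⌋₊ : ℕ) : ℤ)) < x i := by exact_mod_cast hlo'
  have hhi'' : x i < ((⌊δ⁻¹ ^ 2⌋₊ : ℕ) : ℤ) := by exact_mod_cast hhi'
  exact ⟨hlo''.le, hhi''.le⟩

/-- **(D) holds for every term of the realising sequence.**  For `ν` any Gibbs measure of the
nearest-neighbour Ising specification of `ℤ³` (e.g. the critical plus state), field strength `ρ ≠ 0`, mesh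
`0 < δ ≤ 1/2` and width `ε > δ`, the law `spinFieldLaw ν (box 3 ⌊δ⁻²⌋) δ ρ` — the `δ`-term of the sequence
whose limit in law realises the scaling limit in `fieldRealisation_proof` — satisfies the decoupling
inequality (D_ε) across the unit sphere (`stub_sphereDecoupling_gibbs` + `mem_box_of_norm_smul_le`).
[cite: FriedliVelenik2017, Exercise 3.11, eq. (3.26)] -/
theorem sphereDecoupling_approximants {ν : Measure (SpinConfig (Site 3))} {β h : ℝ}
    (hν : ν ∈ isingGibbsMeasures 3 β h) {δ ρ ε : ℝ} (hδ : 0 < δ) (hδ2 : δ ≤ 1 / 2) (hρ : ρ ≠ 0)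
    (hδε : δ < ε) {w v : 𝓢(EuclideanSpace ℝ (Fin 3), ℝ)}
    (hw : tsupport ⇑w ⊆ Metric.ball (0 : EuclideanSpace ℝ (Fin 3)) 1)
    (hv : tsupport ⇑v ⊆ (Metric.closedBall (0 : EuclideanSpace ℝ (Fin 3)) (1 + ε))ᶜ) :
    |∫ ω, ω w * ω v ∂(spinFieldLaw ν (box 3 ⌊δ⁻¹ ^ 2⌋₊) δ ρ)| ≤
      Real.sqrt (∫ ω, ((spinFieldLaw ν (box 3 ⌊δ⁻¹ ^ 2⌋₊) δ ρ)[
          (fun ω : FieldConfig (EuclideanSpace ℝ (Fin 3)) => ω w) |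
          fieldSigma (Metric.thickening ε (Metric.sphere (0 : EuclideanSpace ℝ (Fin 3)) 1))]) ω ^ 2
          ∂(spinFieldLaw ν (box 3 ⌊δ⁻¹ ^ 2⌋₊) δ ρ)) *
      Real.sqrt (∫ ω, (ω v) ^ 2 ∂(spinFieldLaw ν (box 3 ⌊δ⁻¹ ^ 2⌋₊) δ ρ)) :=
  sphereDecoupling_spinFieldLaw_of_isGibbs ((mem_isingGibbsMeasures_iff 3 β h ν).1 hν) _ hδ hρ hδε
    (fun _ hx => mem_box_of_norm_smul_le hδ hδ2 hx) hw hv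

/-! ### The crux from inheritance along the realising sequence -/

open Summit.CriticalPhenomena.Ising3DConformalLimit.MoebiusLimitExistsNegative in
open Summit.CriticalPhenomena.Ising3DConformalLimit.MarkovRigidityFieldRealisation in
open Classical in
/-- **The crux from the inheritance statement `stub_sphereDecoupling_inheritance`** (its statement
verbatim as hypothesis; conclusion `GaussianLimitIsFree` by name; real proof): normalise `S`, identify it
with `(√A)ⁿ·W_{Δ'}` (`gaussian_normalised_eq_gff`, `Δ' = Δ`), take the critical plus DLR state `ν`
(`exists_plusMeasure_holds`) and the Minlos limit law `μ` of `spinFieldLaw ν (box 3 ⌊δ⁻²⌋) δ (ρ δ)`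
(`exists_limitLaw`, with its moments `hasAllMoments_limitLaw`, `integrable_exp_eval_limitLaw`,
`moment_limitLaw_eq` — the construction of `fieldRealisation_proof`, opened), get Gaussianity from
`stub_newmanGaussianity`, apply the hypothesis to THIS sequence, and conclude by
`delta_eq_half_of_sphereDecoupling`. [cite: GlimmJaffe1987, §6.1] -/
theorem GaussianLimitIsFree_of_inheritance
    (hINH : ∀ (ρ : ℝ → ℝ) (Δ A : ℝ) (S : Literature.Probability.LatticeModels.CorrFamily 3) (μ : MeasureTheory.Measure (Literature.MathematicalPhysics.QuantumLattice.FieldConfig (EuclideanSpace ℝ (Fin 3)))), (∀ δ ∈ Set.Ioc (0:ℝ) 1, 0 < ρ δ) → Literature.Probability.LatticeModels.HasPointwiseScalingLimit (Literature.Probability.LatticeModels.criticalCorr 3) ρ S → (∀ n z, z ∉ Literature.Probability.LatticeModels.NonCoincident 3 n → S n z = 0) → Literature.Probability.LatticeModels.IsNondegenerateTwoPoint S → Literature.Probability.LatticeModels.IsTranslationInvariant S → Literature.Probability.LatticeModels.IsScaleCovariant Δ S → 0 < A → (∀ (n : ℕ) (x : Fin n → EuclideanSpace ℝ (Fin 3)),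 S n x = Real.sqrt A ^ n * Summit.CriticalPhenomena.Ising3DConformalLimit.MoebiusLimitExistsOnlyInteraction.wickPower Δ n x) → MeasureTheory.IsProbabilityMeasure μ → Literature.MathematicalPhysics.QuantumLattice.HasAllMoments μ → (∀ f : SchwartzMap (EuclideanSpace ℝ (Fin 3)) ℝ, MeasureTheory.Integrable (fun ω : Literature.MathematicalPhysics.QuantumLattice.FieldConfig (EuclideanSpace ℝ (Fin 3)) => Real.exp (ω f)) μ) → (∀ (n : ℕ) (f : Fin n → SchwartzMap (EuclideanSpace ℝ (Fin 3)) ℝ), Literature.MathematicalPhysics.QuantumLattice.moment μ n f = ∫ x : Fin n → EuclideanSpace ℝ (Fin 3), S n x * ∏ i, f i (x i)) → Literature.MathematicalPhysics.QuantumLattice.IsGaussianField μ → ∀ (ν : MeasureTheory.Measure (Literature.Probability.LatticeModels.SpinConfig (Literature.Probability.LatticeModels.Site 3))), ν ∈ Literature.Probability.LatticeModels.isingGibbsMeasures 3 (Literature.Probability.LatticeModels.criticalBeta 3) 0 → (∀ B : Finset (Literature.Probability.LatticeModels.Site 3), Literature.Probability.LatticeModels.spinCorr ν B = Literature.Probability.LatticeModels.plusCorr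 3 (Literature.Probability.LatticeModels.criticalBeta 3) 0 B) → Literature.MathematicalPhysics.QuantumLattice.TendstoInLaw (fun δ : ℝ => Literature.MathematicalPhysics.QuantumLattice.spinFieldLaw ν (Literature.Probability.LatticeModels.box 3 ⌊δ⁻¹ ^ 2⌋₊) δ (ρ δ)) (nhdsWithin (0 : ℝ) (Set.Ioi 0)) μ → ∀ (ε : ℝ), 0 < ε → ∀ (w v : SchwartzMap (EuclideanSpace ℝ (Fin 3)) ℝ), tsupport ⇑w ⊆ Metric.ball (0 : EuclideanSpace ℝ (Fin 3)) 1 → tsupport ⇑v ⊆ (Metric.closedBall (0 : EuclideanSpace ℝ (Fin 3)) (1 + ε))ᶜ → |∫ ω, ω w * ω v ∂μ| ≤ Real.sqrt (∫ ω, (MeasureTheory.condExp (Literature.MathematicalPhysics.QuantumLattice.fieldSigma (Metric.thickening ε (Metric.sphere (0 : EuclideanSpace ℝ (Fin 3)) 1))) μ (fun ω : Literature.MathematicalPhysics.QuantumLattice.FieldConfig (EuclideanSpace ℝ (Fin 3)) => ω w)) ω ^ 2 ∂μ) * Real.sqrt (∫ ω, (ω v) ^ 2 ∂μ)) :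
    GaussianLimitIsFree := by
  intro ρ Δ S hρ hlim hnd htr hsc hU4
  -- Step 0: normalise `S` off the non-coincident configurations.
  set S' : CorrFamily 3 := fun n x => if x ∈ NonCoincident 3 n then S n x else 0 with hS'
  have hlim' : HasPointwiseScalingLimit (criticalCorr 3) ρ S' := normalised_hasLimit hlim
  have hnd' : IsNondegenerateTwoPoint S' := normalised_nondeg hnd
  have htr' : IsTranslationInvariant S' := normalised_translation htr
  have hsc' : IsScaleCovariant Δ S' := normalised_scale hsc
  have hU4' : ¬ HasNontrivialU4 S' := fun h => hU4 (hasNontrivialU4_normalised_iff.1 h)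
  have hzero' : ∀ n z, z ∉ NonCoincident 3 n → S' n z = 0 := fun n z hz => if_neg hz
  have hU' : ∀ z ∈ NonCoincident 3 4, limitConnectedFour S' z = 0 := by
    intro z hz
    by_contra h
    exact hU4' ⟨z, hz, h⟩
  -- Step 1: `S' = (√A)ⁿ · W_{Δ'}`, `Δ' ∈ [1/2, 3/4]`, `Δ' = Δ`.
  obtain ⟨Δ', hΔ'win, hscΔ', hgff⟩ :=
    Summit.CriticalPhenomena.Ising3DConformalLimit.PerfectScreeningGaussianLimitIsCoulomb.gaussian_normalised_eq_gff
      hρ hlim' hzero' hnd' hU'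
  set A : ℝ := S' 2 ![0, axisUnit] with hA
  have hApos : 0 < A := hnd' _ (zero_unitVec_mem_nonCoincident (t := (1 : ℝ)) one_ne_zero)
  have hΔ : Δ = Δ' := delta_eq_of_isScaleCovariant' hnd' hsc' hscΔ'
  have hΔ'le : Δ' ≤ 1 := hΔ'win.2.trans (by norm_num)
  have hΔ0 : 0 < Δ' := by linarith [hΔ'win.1]
  have hΔ32 : Δ' < 3 / 2 := by linarith [hΔ'win.2]
  -- Step 2: the realising sequence — critical plus DLR state, boxes `⌊δ⁻²⌋`, Minlos limit law.
  obtain ⟨ν, hνG, -, hν⟩ := exists_plusMeasure_holds (d := 3) (β := criticalBeta 3) (h := 0)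
    (criticalBeta_nonneg 3)
  haveI : IsProbabilityMeasure ν := ((mem_isingGibbsMeasures_iff 3 _ 0 ν).1 hνG).isProbabilityMeasure
  have hL := tendsto_mesh_mul_boxSide
  obtain ⟨μ, hμP, -, hlaw⟩ :=
    exists_limitLaw (L := fun δ : ℝ => ⌊δ⁻¹ ^ 2⌋₊) hlim' hnd' hscΔ' hΔ0 hΔ32 hν hL
  haveI := hμP
  have hμall : HasAllMoments μ := hasAllMoments_limitLaw hlim' hnd' hscΔ' hΔ0 hΔ32 hν hL hlaw
  have hμexp : ∀ f : SchwartzMap (EuclideanSpace ℝ (Fin 3)) ℝ,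
      Integrable (fun ω : FieldConfig (EuclideanSpace ℝ (Fin 3)) => Real.exp (ω f)) μ :=
    fun f => integrable_exp_eval_limitLaw hlim' hnd' hscΔ' hΔ0 hΔ32 hν hL hlaw f
  have hμmom : ∀ (n : ℕ) (f : Fin n → SchwartzMap (EuclideanSpace ℝ (Fin 3)) ℝ),
      Literature.MathematicalPhysics.QuantumLattice.moment μ n f =
        ∫ x : Fin n → EuclideanSpace ℝ (Fin 3), S' n x * ∏ i, f i (x i) := by
    intro n f
    rw [moment_limitLaw_eq hlim' hnd' hscΔ' hΔ0 hΔ32 hν hL hlaw f]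
    exact integral_congr_ae (Eventually.of_forall fun x => mul_comm _ _)
  have hμmomW : ∀ (n : ℕ) (f : Fin n → SchwartzMap (EuclideanSpace ℝ (Fin 3)) ℝ),
      Literature.MathematicalPhysics.QuantumLattice.moment μ n f =
        ∫ x : Fin n → EuclideanSpace ℝ (Fin 3), (Real.sqrt A ^ n * wickPower Δ' n x) * ∏ i, f i (x i) := by
    intro n f
    rw [hμmom n f]
    refine integral_congr_ae (Eventually.of_forall fun x => ?_)
    simp only [hgff n x]
  -- Step 3: Gaussianity (Newman; tree theorem).
  have hG : Literature.MathematicalPhysics.QuantumLattice.IsGaussianField μ :=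
    stub_newmanGaussianity Δ' A μ hApos hΔ'win.1 hΔ'le hμP hμall hμexp hμmomW
  -- Step 4: the inheritance hypothesis applied to THIS sequence, then rigidity.
  have hDμ := hINH ρ Δ' A S' μ hρ hlim' hzero' hnd' htr' hscΔ' hApos hgff hμP hμall hμexp hμmom hG
    ν hνG hν hlaw
  rw [hΔ]
  exact delta_eq_half_of_sphereDecoupling Δ' A μ hApos hΔ'win.1 hΔ'le hμP hG hμmomW 1 one_pos
    (fun ε hε _ w v hw hv => hDμ ε hε w v hw hv)

/-- **Registered form (sub-goal `stub_crux_of_inheritance` of crux stmt-CriticalPhenomena-2601, skeleton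
v11): the crux BY NAME from the inheritance statement** — `GaussianLimitIsFree_of_inheritance` verbatim.
[cite: GlimmJaffe1987, §6.1] -/
theorem stub_crux_of_inheritance :
    (∀ (ρ : ℝ → ℝ) (Δ A : ℝ) (S : Literature.Probability.LatticeModels.CorrFamily 3) (μ : MeasureTheory.Measure (Literature.MathematicalPhysics.QuantumLattice.FieldConfig (EuclideanSpace ℝ (Fin 3)))), (∀ δ ∈ Set.Ioc (0:ℝ) 1, 0 < ρ δ) → Literature.Probability.LatticeModels.HasPointwiseScalingLimit (Literature.Probability.LatticeModels.criticalCorr 3) ρ S → (∀ n z, z ∉ Literature.Probability.LatticeModels.NonCoincident 3 n → S n z = 0) → Literature.Probability.LatticeModels.IsNondegenerateTwoPoint S → Literature.Probability.LatticeModels.IsTranslationInvariant S → Literature.Probability.LatticeModels.IsScaleCovariant Δ S → 0 < A → (∀ (n : ℕ) (x : Fin n → EuclideanSpace ℝ (Fin 3)), S n x = Real.sqrt A ^ n * Summit.CriticalPhenomena.Ising3DConformalLimit.MoebiusLimitExistsOnlyInteraction.wickPower Δ n x) → MeasureTheory.IsProbabilityMeasure μ → Literature.MathematicalPhysics.QuantumLattice.HasAllMoments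 μ → (∀ f : SchwartzMap (EuclideanSpace ℝ (Fin 3)) ℝ, MeasureTheory.Integrable (fun ω : Literature.MathematicalPhysics.QuantumLattice.FieldConfig (EuclideanSpace ℝ (Fin 3)) => Real.exp (ω f)) μ) → (∀ (n : ℕ) (f : Fin n → SchwartzMap (EuclideanSpace ℝ (Fin 3)) ℝ), Literature.MathematicalPhysics.QuantumLattice.moment μ n f = ∫ x : Fin n → EuclideanSpace ℝ (Fin 3), S n x * ∏ i, f i (x i)) → Literature.MathematicalPhysics.QuantumLattice.IsGaussianField μ → ∀ (ν : MeasureTheory.Measure (Literature.Probability.LatticeModels.SpinConfig (Literature.Probability.LatticeModels.Site 3))), ν ∈ Literature.Probability.LatticeModels.isingGibbsMeasures 3 (Literature.Probability.LatticeModels.criticalBeta 3) 0 → (∀ B : Finset (Literature.Probability.LatticeModels.Site 3), Literature.Probability.LatticeModels.spinCorr ν B = Literature.Probability.LatticeModels.plusCorr 3 (Literature.Probability.LatticeModels.criticalBeta 3) 0 B) → Literature.MathematicalPhysics.QuantumLattice.TendstoInLaw (fun δ : ℝ => Literature.MathematicalPhysics.QuantumLattice.spinFieldLaw ν (Literature.Probability.LatticeModels.box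 3 ⌊δ⁻¹ ^ 2⌋₊) δ (ρ δ)) (nhdsWithin (0 : ℝ) (Set.Ioi 0)) μ → ∀ (ε : ℝ), 0 < ε → ∀ (w v : SchwartzMap (EuclideanSpace ℝ (Fin 3)) ℝ), tsupport ⇑w ⊆ Metric.ball (0 : EuclideanSpace ℝ (Fin 3)) 1 → tsupport ⇑v ⊆ (Metric.closedBall (0 : EuclideanSpace ℝ (Fin 3)) (1 + ε))ᶜ → |∫ ω, ω w * ω v ∂μ| ≤ Real.sqrt (∫ ω, (MeasureTheory.condExp (Literature.MathematicalPhysics.QuantumLattice.fieldSigma (Metric.thickening ε (Metric.sphere (0 : EuclideanSpace ℝ (Fin 3)) 1))) μ (fun ω : Literature.MathematicalPhysics.QuantumLattice.FieldConfig (EuclideanSpace ℝ (Fin 3)) => ω w)) ω ^ 2 ∂μ) * Real.sqrt (∫ ω, (ω v) ^ 2 ∂μ)) → Summit.CriticalPhenomena.Ising3DConformalLimit.Theses.AnomalousForcesInteraction.GaussianLimitIsFree :=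
  GaussianLimitIsFree_of_inheritance

/-- **v10 ⇒ v11**: the decoupling statement for every realised Gaussian law (the v10 stub
`stub_sphereDecoupling_limit`) implies the inheritance statement (drop the lattice hypotheses); hence
crux 11236, its ball stub and the thick-shell inheritance (…Reductions.lean) discharge the v11 stub too.
[folklore] -/
theorem inheritance_of_sphereDecoupling
    (hD : ∀ (ρ : ℝ → ℝ) (Δ A : ℝ) (S : Literature.Probability.LatticeModels.CorrFamily 3) (μ : MeasureTheory.Measure (Literature.MathematicalPhysics.QuantumLattice.FieldConfig (EuclideanSpace ℝ (Fin 3)))), (∀ δ ∈ Set.Ioc (0:ℝ) 1, 0 < ρ δ) → Literature.Probability.LatticeModels.HasPointwiseScalingLimit (Literature.Probability.LatticeModels.criticalCorr 3) ρ S → (∀ n z, z ∉ Literature.Probability.LatticeModels.NonCoincident 3 n → S n z = 0) → Literature.Probability.LatticeModels.IsNondegenerateTwoPoint S → Literature.Probability.LatticeModels.IsTranslationInvariant S → Literature.Probability.LatticeModels.IsScaleCovariant Δ S → 0 < A → (∀ (n : ℕ) (x : Fin n → EuclideanSpace ℝ (Fin 3)), S n x = Real.sqrt A ^ n * Summit.CriticalPhenomena.Ising3DConformalLimit.MoebiusLimitExistsOnlyInteraction.wickPower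 Δ n x) → MeasureTheory.IsProbabilityMeasure μ → Literature.MathematicalPhysics.QuantumLattice.HasAllMoments μ → (∀ f : SchwartzMap (EuclideanSpace ℝ (Fin 3)) ℝ, MeasureTheory.Integrable (fun ω : Literature.MathematicalPhysics.QuantumLattice.FieldConfig (EuclideanSpace ℝ (Fin 3)) => Real.exp (ω f)) μ) → (∀ (n : ℕ) (f : Fin n → SchwartzMap (EuclideanSpace ℝ (Fin 3)) ℝ), Literature.MathematicalPhysics.QuantumLattice.moment μ n f = ∫ x : Fin n → EuclideanSpace ℝ (Fin 3), S n x * ∏ i, f i (x i)) → Literature.MathematicalPhysics.QuantumLattice.IsGaussianField μ → ∀ (ε : ℝ), 0 < ε → ∀ (w v : SchwartzMap (EuclideanSpace ℝ (Fin 3)) ℝ), tsupport ⇑w ⊆ Metric.ball (0 : EuclideanSpace ℝ (Fin 3)) 1 → tsupport ⇑v ⊆ (Metric.closedBall (0 : EuclideanSpace ℝ (Fin 3)) (1 + ε))ᶜ → |∫ ω, ω w * ω v ∂μ| ≤ Real.sqrt (∫ ω, (MeasureTheory.condExp (Literature.MathematicalPhysics.QuantumLattice.fieldSigma (Metric.thickening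 ε (Metric.sphere (0 : EuclideanSpace ℝ (Fin 3)) 1))) μ (fun ω : Literature.MathematicalPhysics.QuantumLattice.FieldConfig (EuclideanSpace ℝ (Fin 3)) => ω w)) ω ^ 2 ∂μ) * Real.sqrt (∫ ω, (ω v) ^ 2 ∂μ)) :
    ∀ (ρ : ℝ → ℝ) (Δ A : ℝ) (S : Literature.Probability.LatticeModels.CorrFamily 3) (μ : MeasureTheory.Measure (Literature.MathematicalPhysics.QuantumLattice.FieldConfig (EuclideanSpace ℝ (Fin 3)))), (∀ δ ∈ Set.Ioc (0:ℝ) 1, 0 < ρ δ) → Literature.Probability.LatticeModels.HasPointwiseScalingLimit (Literature.Probability.LatticeModels.criticalCorr 3) ρ S → (∀ n z, z ∉ Literature.Probability.LatticeModels.NonCoincident 3 n → S n z = 0) → Literature.Probability.LatticeModels.IsNondegenerateTwoPoint S → Literature.Probability.LatticeModels.IsTranslationInvariant S → Literature.Probability.LatticeModels.IsScaleCovariant Δ S → 0 < A → (∀ (n : ℕ) (x : Fin n → EuclideanSpace ℝ (Fin 3)), S n x = Real.sqrt A ^ n * Summit.CriticalPhenomena.Ising3DConformalLimit.MoebiusLimitExistsOnlyInteraction.wickPower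 Δ n x) → MeasureTheory.IsProbabilityMeasure μ → Literature.MathematicalPhysics.QuantumLattice.HasAllMoments μ → (∀ f : SchwartzMap (EuclideanSpace ℝ (Fin 3)) ℝ, MeasureTheory.Integrable (fun ω : Literature.MathematicalPhysics.QuantumLattice.FieldConfig (EuclideanSpace ℝ (Fin 3)) => Real.exp (ω f)) μ) → (∀ (n : ℕ) (f : Fin n → SchwartzMap (EuclideanSpace ℝ (Fin 3)) ℝ), Literature.MathematicalPhysics.QuantumLattice.moment μ n f = ∫ x : Fin n → EuclideanSpace ℝ (Fin 3), S n x * ∏ i, f i (x i)) → Literature.MathematicalPhysics.QuantumLattice.IsGaussianField μ → ∀ (ν : MeasureTheory.Measure (Literature.Probability.LatticeModels.SpinConfig (Literature.Probability.LatticeModels.Site 3))), ν ∈ Literature.Probability.LatticeModels.isingGibbsMeasures 3 (Literature.Probability.LatticeModels.criticalBeta 3) 0 → (∀ B : Finset (Literature.Probability.LatticeModels.Site 3), Literature.Probability.LatticeModels.spinCorr ν B = Literature.Probability.LatticeModels.plusCorr 3 (Literature.Probability.LatticeModels.criticalBeta 3) 0 B) → Literature.MathematicalPhysics.QuantumLattice.TendstoInLaw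 (fun δ : ℝ => Literature.MathematicalPhysics.QuantumLattice.spinFieldLaw ν (Literature.Probability.LatticeModels.box 3 ⌊δ⁻¹ ^ 2⌋₊) δ (ρ δ)) (nhdsWithin (0 : ℝ) (Set.Ioi 0)) μ → ∀ (ε : ℝ), 0 < ε → ∀ (w v : SchwartzMap (EuclideanSpace ℝ (Fin 3)) ℝ), tsupport ⇑w ⊆ Metric.ball (0 : EuclideanSpace ℝ (Fin 3)) 1 → tsupport ⇑v ⊆ (Metric.closedBall (0 : EuclideanSpace ℝ (Fin 3)) (1 + ε))ᶜ → |∫ ω, ω w * ω v ∂μ| ≤ Real.sqrt (∫ ω, (MeasureTheory.condExp (Literature.MathematicalPhysics.QuantumLattice.fieldSigma (Metric.thickening ε (Metric.sphere (0 : EuclideanSpace ℝ (Fin 3)) 1))) μ (fun ω : Literature.MathematicalPhysics.QuantumLattice.FieldConfig (EuclideanSpace ℝ (Fin 3)) => ω w)) ω ^ 2 ∂μ) * Real.sqrt (∫ ω, (ω v) ^ 2 ∂μ) := by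
  intro ρ Δ A S μ hρ hlim hzero hnd htr hsc hA hS hμP hall hexp hmom hG _ν _hν _hνc _hlaw
  exact hD ρ Δ A S μ hρ hlim hzero hnd htr hsc hA hS hμP hall hexp hmom hG

/-- **Crux 11236 ⇒ the v11 stub** (through `stub_markovInheritance_of_markovInheritance`,
`sphereDecoupling_of_germMarkovBalls`, `inheritance_of_sphereDecoupling`). [folklore] -/
theorem inheritance_of_markovInheritance
    (hMI : Summit.CriticalPhenomena.Ising3DConformalLimit.Theses.MarkovRigidity.MarkovInheritance) :
    ∀ (ρ : ℝ → ℝ) (Δ A : ℝ) (S : Literature.Probability.LatticeModels.CorrFamily 3) (μ : MeasureTheory.Measure (Literature.MathematicalPhysics.QuantumLattice.FieldConfig (EuclideanSpace ℝ (Fin 3)))), (∀ δ ∈ Set.Ioc (0:ℝ) 1, 0 < ρ δ) → Literature.Probability.LatticeModels.HasPointwiseScalingLimit (Literature.Probability.LatticeModels.criticalCorr 3) ρ S → (∀ n z, z ∉ Literature.Probability.LatticeModels.NonCoincident 3 n → S n z = 0) → Literature.Probability.LatticeModels.IsNondegenerateTwoPoint S → Literature.Probability.LatticeModels.IsTranslationInvariant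 S → Literature.Probability.LatticeModels.IsScaleCovariant Δ S → 0 < A → (∀ (n : ℕ) (x : Fin n → EuclideanSpace ℝ (Fin 3)), S n x = Real.sqrt A ^ n * Summit.CriticalPhenomena.Ising3DConformalLimit.MoebiusLimitExistsOnlyInteraction.wickPower Δ n x) → MeasureTheory.IsProbabilityMeasure μ → Literature.MathematicalPhysics.QuantumLattice.HasAllMoments μ → (∀ f : SchwartzMap (EuclideanSpace ℝ (Fin 3)) ℝ, MeasureTheory.Integrable (fun ω : Literature.MathematicalPhysics.QuantumLattice.FieldConfig (EuclideanSpace ℝ (Fin 3)) => Real.exp (ω f)) μ) → (∀ (n : ℕ) (f : Fin n → SchwartzMap (EuclideanSpace ℝ (Fin 3)) ℝ), Literature.MathematicalPhysics.QuantumLattice.moment μ n f = ∫ x : Fin n → EuclideanSpace ℝ (Fin 3), S n x * ∏ i, f i (x i)) → Literature.MathematicalPhysics.QuantumLattice.IsGaussianField μ → ∀ (ν : MeasureTheory.Measure (Literature.Probability.LatticeModels.SpinConfig (Literature.Probability.LatticeModels.Site 3))), ν ∈ Literature.Probability.LatticeModels.isingGibbsMeasures 3 (Literature.Probability.LatticeModels.criticalBeta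 3) 0 → (∀ B : Finset (Literature.Probability.LatticeModels.Site 3), Literature.Probability.LatticeModels.spinCorr ν B = Literature.Probability.LatticeModels.plusCorr 3 (Literature.Probability.LatticeModels.criticalBeta 3) 0 B) → Literature.MathematicalPhysics.QuantumLattice.TendstoInLaw (fun δ : ℝ => Literature.MathematicalPhysics.QuantumLattice.spinFieldLaw ν (Literature.Probability.LatticeModels.box 3 ⌊δ⁻¹ ^ 2⌋₊) δ (ρ δ)) (nhdsWithin (0 : ℝ) (Set.Ioi 0)) μ → ∀ (ε : ℝ), 0 < ε → ∀ (w v : SchwartzMap (EuclideanSpace ℝ (Fin 3)) ℝ), tsupport ⇑w ⊆ Metric.ball (0 : EuclideanSpace ℝ (Fin 3)) 1 → tsupport ⇑v ⊆ (Metric.closedBall (0 : EuclideanSpace ℝ (Fin 3)) (1 + ε))ᶜ → |∫ ω, ω w * ω v ∂μ| ≤ Real.sqrt (∫ ω, (MeasureTheory.condExp (Literature.MathematicalPhysics.QuantumLattice.fieldSigma (Metric.thickening ε (Metric.sphere (0 : EuclideanSpace ℝ (Fin 3)) 1))) μ (fun ω : Literature.MathematicalPhysics.QuantumLattice.FieldConfig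 (EuclideanSpace ℝ (Fin 3)) => ω w)) ω ^ 2 ∂μ) * Real.sqrt (∫ ω, (ω v) ^ 2 ∂μ) :=
  inheritance_of_sphereDecoupling
    (sphereDecoupling_of_germMarkovBalls (stub_markovInheritance_of_markovInheritance hMI))

end Summit.CriticalPhenomena.Ising3DConformalLimit.Cruxes.GaussianLimitIsFree.Birth

end
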